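import Literature.Analysis.FluidPDE.CaloricDualityTerms
import Literature.Analysis.FluidPDE.EssCurry
import Mathlib.Analysis.Distribution.AEEqOfIntegralContDiff
import Mathlib.Analysis.Calculus.LineDeriv.IntegrationByParts
import HarnessLib

/-!
# Compactly supported `C²` functions are the heat potentials of `(∂ₜ ∓ Δ)` of themselves

Analysis/FluidPDE support file (everything proved) on the discharge path of the named fact
`Literature.Analysis.FluidPDE.Carleman.seregin_backwardHeat_localMax_le_L2`
(`BackwardHeatRegularity.lean`; Seregin 2014, App. A.2, Remark A.2: the local maximum of
`|u| + |∇u|` of a solution of the backward heat inequality `|∂ₜu + Δu| ≤ c₁(|u| + |∇u|)` is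
controlled by `‖u‖_{L²}` — an interior estimate of the regularity theory of parabolic equations,
Ladyženskaja–Solonnikov–Ural'ceva 1968, which Seregin quotes without proof). Our proof of that
estimate represents a cut-off of the solution through the fundamental solution of the heat
equation; this file proves the representation formulas, for **scalar** space–time functions
`W : ℝ × E → ℝ` (time first, uncurried, the frame operators `Carleman.dt`, `Carleman.dx`,
`Carleman.lap` of `CarlemanCalculus.lean`) of class `C²` with compact support on `ℝ × E`, `E` a
finite-dimensional real inner product space with its Lebesgue measure, `G_a` the Gauss–Weierstrass
kernel (`UnboundedOperators.heatKernel a`), `∂ᵥG_a = heatKernelGrad v a`, and `backKernel` the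
backward space–time kernel of `CaloricBackwardKernels.lean`
(`backKernel κ (τ, y) = κ(-τ)(y)` for `τ < 0`, `0` for `τ ≥ 0`):

* `eq_integral_backKernel_mul_dt_sub_lap` — **Duhamel's formula for the heat operator**:
  `W(z) = ∫ backKernel G (w - z) (∂ₜW - ΔW)(w) dw = ∫_{s < t} ∫ G_{t-s}(y - x) (∂ₜW - ΔW)(s, y)`,
  `z = (t, x)`;
* `dx_eq_neg_integral_backKernel_mul_dt_sub_lap` — its gradient:
  `∂ᵥW(z) = -∫ backKernel (∂ᵥG) (w - z) (∂ₜW - ΔW)(w) dw`;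
* `eq_neg_integral_backKernel_mul_dt_add_lap`, `dx_eq_integral_backKernel_mul_dt_add_lap` — the
  time-reflected versions for the **backward** heat operator `∂ₜ + Δ`:
  `W(z) = -∫ backKernel G (t - s, y - x) (∂ₜW + ΔW)(s, y)` (an integral over the future `s > t`)
  and `∂ᵥW(z) = ∫ backKernel (∂ᵥG) (t - s, y - x) (∂ₜW + ΔW)(s, y)`.

## Proof

Duality with the tree's backward caloric Duhamel integral `η = 𝒰[g]` of a space–time test
function `g` (`HeatDuhamelBack.lean`): `η` is jointly smooth, solves `∂ₜη + Δη = -g`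
(`timeDeriv_add_laplacian_heatDuhamelBack_one`) and is the space–time potential
`η = backKernel G ⋆ g̃`, `∂ᵥη = backKernel ∂ᵥG ⋆ g̃` (`CaloricDuhamelRepresentation.lean`). Two
integrations by parts on `ℝ × E` without boundary terms (Mathlib's
`integral_mul_fderiv_eq_neg_fderiv_mul_of_integrable`, all products having a compactly supported
factor) give `∫ W g̃ = ∫ (∂ₜW - ΔW) η`; the adjoint identity of `CaloricPotentialContinuity.lean`
turns the right side into `∫ g̃ · (Ǩ ⋆ F)`, `F = ∂ₜW - ΔW`, with `Ǩ ⋆ F` continuous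
(`duality_term_sliceBound`); as `g̃` is an arbitrary test function, `W = Ǩ ⋆ F` a.e.
(`ae_eq_of_integral_contDiff_smul_eq`), hence everywhere by continuity. The gradient formula is
the same computation for the test function `∂ᵥg` (`𝒰[∂ᵥg] = ∂ᵥ𝒰[g]`), and the backward versions
follow by the time reflection `(t, x) ↦ (-t, x)`, which preserves Lebesgue measure.

This is Evans, *PDE*, §2.3.1 (c), Thm. 2 (Duhamel's principle; solution of the nonhomogeneous
problem) read backwards: a compactly supported `C²` function *is* the solution with source
`(∂ₜ - Δ)W`.

## References

* L. C. Evans, *Partial Differential Equations*, 2nd ed., AMS 2010, §2.3.1, Thm. 2–3.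
* O. A. Ladyženskaja, V. A. Solonnikov, N. N. Ural'ceva, *Linear and quasi-linear equations of
  parabolic type*, AMS 1968, Ch. IV §1 (heat potentials).
-/

noncomputable section

open MeasureTheory Set Function Filter ContinuousLinearMap TopologicalSpace
open scoped Topology RealInnerProductSpace Convolution Laplacian

namespace Literature.Analysis.FluidPDE

namespace Carleman

variable {E : Type*} [NormedAddCommGroup E] [InnerProductSpace ℝ E] [FiniteDimensional ℝ E]
  [MeasurableSpace E] [BorelSpace E]

/-! ### Regularity of `∂ₜW`, `∂ᵥW`, `ΔW` for `W ∈ C²` -/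

section Regularity

variable {F : Type*} [NormedAddCommGroup F] [NormedSpace ℝ F] {W : ℝ × E → F}

omit [FiniteDimensional ℝ E] [MeasurableSpace E] [BorelSpace E] in
/-- A directional derivative of a `C²` function is `C¹`. [folklore] -/
theorem contDiff_one_fderiv_apply_of_contDiff_two (hW : ContDiff ℝ 2 W) (w : ℝ × E) :
    ContDiff ℝ 1 fun z => fderiv ℝ W z w :=
  (hW.fderiv_right (m := 1) le_rfl).clm_apply contDiff_const

omit [FiniteDimensional ℝ E] [MeasurableSpace E] [BorelSpace E] in
/-- `∂ₜW ∈ C¹` for `W ∈ C²`. [folklore] -/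
theorem contDiff_one_dt_of_contDiff_two (hW : ContDiff ℝ 2 W) : ContDiff ℝ 1 (dt W) :=
  contDiff_one_fderiv_apply_of_contDiff_two hW _

omit [FiniteDimensional ℝ E] [MeasurableSpace E] [BorelSpace E] in
/-- `∂ₑW ∈ C¹` for `W ∈ C²`. [folklore] -/
theorem contDiff_one_dx_of_contDiff_two (hW : ContDiff ℝ 2 W) (e : E) : ContDiff ℝ 1 (dx e W) :=
  contDiff_one_fderiv_apply_of_contDiff_two hW _

omit [FiniteDimensional ℝ E] [MeasurableSpace E] [BorelSpace E] in
/-- `∂ₜW` is continuous for `W ∈ C²`. [folklore] -/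
theorem continuous_dt_of_contDiff_two (hW : ContDiff ℝ 2 W) : Continuous (dt W) :=
  (contDiff_one_dt_of_contDiff_two hW).continuous

omit [FiniteDimensional ℝ E] [MeasurableSpace E] [BorelSpace E] in
/-- `∂ₑW` is continuous for `W ∈ C²`. [folklore] -/
theorem continuous_dx_of_contDiff_two (hW : ContDiff ℝ 2 W) (e : E) : Continuous (dx e W) :=
  (contDiff_one_dx_of_contDiff_two hW e).continuous

omit [FiniteDimensional ℝ E] [MeasurableSpace E] [BorelSpace E] in
/-- `∂ₑ∂ₑ'W` is continuous for `W ∈ C²`. [folklore] -/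
theorem continuous_dx_dx_of_contDiff_two (hW : ContDiff ℝ 2 W) (e e' : E) :
    Continuous (dx e (dx e' W)) :=
  ((contDiff_one_dx_of_contDiff_two hW e').continuous_fderiv one_ne_zero).clm_apply
    continuous_const

omit [MeasurableSpace E] [BorelSpace E] in
/-- `ΔₓW` is continuous for `W ∈ C²`. [folklore] -/
theorem continuous_lap_of_contDiff_two (hW : ContDiff ℝ 2 W) : Continuous (lap W) := by
  change Continuous fun z => ∑ i, dx (stdOrthonormalBasis ℝ E i) (dx (stdOrthonormalBasis ℝ E i) W) z
  exact continuous_finsetSum _ fun i _ => continuous_dx_dx_of_contDiff_two hW _ _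

omit [MeasurableSpace E] [BorelSpace E] in
/-- The forward source `∂ₜW - ΔₓW` of a `C²` function is continuous. [folklore] -/
theorem continuous_dt_sub_lap (hW : ContDiff ℝ 2 W) : Continuous fun z => dt W z - lap W z :=
  (continuous_dt_of_contDiff_two hW).sub (continuous_lap_of_contDiff_two hW)

omit [MeasurableSpace E] [BorelSpace E] in
/-- The forward source `∂ₜW - ΔₓW` of a compactly supported function is compactly supported.
[folklore] -/
theorem hasCompactSupport_dt_sub_lap (hWc : HasCompactSupport W) :
    HasCompactSupport fun z => dt W z - lap W z :=
  (hasCompactSupport_dt hWc).sub (hasCompactSupport_lap hWc)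

end Regularity

/-! ### Integrability of products with a compactly supported continuous factor -/

section Products

/-- `f k` is integrable on `ℝ × E` if `f` is continuous with compact support and `k` is continuous.
[folklore] -/
theorem integrable_mul_of_hasCompactSupport_left {f k : ℝ × E → ℝ}
    (hf : Continuous f) (hfc : HasCompactSupport f) (hk : Continuous k) :
    Integrable (fun z => f z * k z) (volume : Measure (ℝ × E)) :=
  (hf.mul hk).integrable_of_hasCompactSupport hfc.mul_right

/-- `k f` is integrable on `ℝ × E` if `f` is continuous with compact support and `k` is continuous.
[folklore] -/
theorem integrable_mul_of_hasCompactSupport_right {k f : ℝ × E → ℝ}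
    (hk : Continuous k) (hf : Continuous f) (hfc : HasCompactSupport f) :
    Integrable (fun z => k z * f z) (volume : Measure (ℝ × E)) :=
  (hk.mul hf).integrable_of_hasCompactSupport hfc.mul_left

end Products

/-! ### The backward Duhamel integral of a test function, uncurried -/

section Duhamel

variable {g : ℝ → E → ℝ}

/-- For a space–time test function `g`, the uncurried Duhamel integral
`η̃ (s, x) = 𝒰[g](s)(x)` is smooth. [folklore] -/
theorem contDiff_duhamel_uncurried (hg : IsSpaceTimeTestOn (⊤ : Opens (ℝ × E)) g) :
    ContDiff ℝ ((⊤ : ℕ∞) : WithTop ℕ∞) fun z : ℝ × E => heatDuhamelBack 1 g z.1 z.2 :=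
  hg.contDiff_uncurry_heatDuhamelBack one_pos

/-- **The backward heat equation for `η̃`** in the frame operators:
`∂ₜη̃ + Δₓη̃ = -g̃`. [folklore] -/
theorem dt_add_lap_duhamel_uncurried (hg : IsSpaceTimeTestOn (⊤ : Opens (ℝ × E)) g) (z : ℝ × E) :
    dt (fun w : ℝ × E => heatDuhamelBack 1 g w.1 w.2) z +
      lap (fun w : ℝ × E => heatDuhamelBack 1 g w.1 w.2) z = -g z.1 z.2 := by
  have hη := contDiff_duhamel_uncurried hg
  have h2 : ContDiffOn ℝ 2 (uncurry (heatDuhamelBack 1 g)) univ := (contDiff_two_of_top hη).contDiffOn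
  have hd : DifferentiableAt ℝ (uncurry (heatDuhamelBack 1 g)) (z.1, z.2) :=
    (hη.differentiable (by simp)).differentiableAt
  have e1 : dt (fun w : ℝ × E => heatDuhamelBack 1 g w.1 w.2) z =
      timeDeriv (heatDuhamelBack 1 g) z.1 z.2 := dt_uncurry (u := heatDuhamelBack 1 g) hd
  have e2 : lap (fun w : ℝ × E => heatDuhamelBack 1 g w.1 w.2) z = (Δ (heatDuhamelBack 1 g z.1)) z.2 :=
    lap_uncurry (u := heatDuhamelBack 1 g) isOpen_univ (mem_univ _) h2
  rw [e1, e2]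
  exact timeDeriv_add_laplacian_heatDuhamelBack_one hg z.1 z.2

end Duhamel

/-! ### The duality computation `∫ W g̃ = ∫ (∂ₜW - ΔW) η̃` -/

section Duality

variable {W : ℝ × E → ℝ} {g : ℝ → E → ℝ}

/-- **Testing a compactly supported `C²` function against `g = -(∂ₜ + Δ)𝒰[g]`**:
`∫ W g̃ = ∫ (∂ₜW - ΔₓW) 𝒰[g]~` (two integrations by parts on `ℝ × E`, no boundary terms).
[folklore] -/
theorem integral_mul_test_eq_integral_dt_sub_lap_mul_duhamel (hW : ContDiff ℝ 2 W)
    (hWc : HasCompactSupport W) (hg : IsSpaceTimeTestOn (⊤ : Opens (ℝ × E)) g) :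
    ∫ z, W z * g z.1 z.2 = ∫ z, (dt W z - lap W z) * heatDuhamelBack 1 g z.1 z.2 := by
  haveI : (volume : Measure (ℝ × E)).IsAddHaarMeasure := Measure.prod.instIsAddHaarMeasure _ _
  set η : ℝ × E → ℝ := fun w => heatDuhamelBack 1 g w.1 w.2 with hηdef
  set b := stdOrthonormalBasis ℝ E with hb
  have hη : ContDiff ℝ ((⊤ : ℕ∞) : WithTop ℕ∞) η := contDiff_duhamel_uncurried hg
  have hη2 : ContDiff ℝ 2 η := contDiff_two_of_top hη
  -- continuity / support facts
  have cW : Continuous W := hW.continuous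
  have cη : Continuous η := hη.continuous
  have cdtW := continuous_dt_of_contDiff_two hW
  have cdtη := continuous_dt_of_contDiff_two hη2
  have cdxW : ∀ e, Continuous (dx e W) := continuous_dx_of_contDiff_two hW
  have cdxη : ∀ e, Continuous (dx e η) := continuous_dx_of_contDiff_two hη2
  have cddW : ∀ e, Continuous (dx e (dx e W)) := fun e => continuous_dx_dx_of_contDiff_two hW e e
  have cddη : ∀ e, Continuous (dx e (dx e η)) := fun e => continuous_dx_dx_of_contDiff_two hη2 e e
  have sdtW : HasCompactSupport (dt W) := hasCompactSupport_dt hWc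
  have sdxW : ∀ e, HasCompactSupport (dx e W) := hasCompactSupport_dx hWc
  have sddW : ∀ e, HasCompactSupport (dx e (dx e W)) := fun e =>
    hasCompactSupport_dx (hasCompactSupport_dx hWc e) e
  have dW : ∀ z, DifferentiableAt ℝ W z := fun z => hW.differentiable (by simp) z
  have dη : ∀ z, DifferentiableAt ℝ η z := fun z => hη.differentiable (by simp) z
  have ddxW : ∀ e z, DifferentiableAt ℝ (dx e W) z := fun e z =>
    (contDiff_one_dx_of_contDiff_two hW e).differentiable one_ne_zero z
  have ddxη : ∀ e z, DifferentiableAt ℝ (dx e η) z := fun e z =>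
    (contDiff_one_dx_of_contDiff_two hη2 e).differentiable one_ne_zero z
  -- the equation
  have heq : ∀ z, g z.1 z.2 = -(dt η z + lap η z) := fun z => by
    rw [dt_add_lap_duhamel_uncurried hg z, neg_neg]
  -- (i) time
  have ht : ∫ z, W z * dt η z = -∫ z, dt W z * η z := by
    simp only [dt_apply]
    exact integral_mul_fderiv_eq_neg_fderiv_mul_of_integrable
      (integrable_mul_of_hasCompactSupport_left cdtW sdtW cη)
      (integrable_mul_of_hasCompactSupport_left cW hWc cdtη)
      (integrable_mul_of_hasCompactSupport_left cW hWc cη) (fun z _ => dW z) (fun z _ => dη z)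
  -- (ii) space, coordinate by coordinate
  have hx : ∀ e, ∫ z, W z * dx e (dx e η) z = ∫ z, dx e (dx e W) z * η z := by
    intro e
    have s1 : ∫ z, W z * dx e (dx e η) z = -∫ z, dx e W z * dx e η z := by
      simp only [dx_apply]
      exact integral_mul_fderiv_eq_neg_fderiv_mul_of_integrable
        (integrable_mul_of_hasCompactSupport_left (cdxW e) (sdxW e) (cdxη e))
        (integrable_mul_of_hasCompactSupport_left cW hWc (cddη e))
        (integrable_mul_of_hasCompactSupport_left cW hWc (cdxη e)) (fun z _ => dW z)
        (fun z _ => ddxη e z)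
    have s2 : ∫ z, dx e W z * dx e η z = -∫ z, dx e (dx e W) z * η z := by
      simp only [dx_apply]
      exact integral_mul_fderiv_eq_neg_fderiv_mul_of_integrable
        (integrable_mul_of_hasCompactSupport_left (cddW e) (sddW e) cη)
        (integrable_mul_of_hasCompactSupport_left (cdxW e) (sdxW e) (cdxη e))
        (integrable_mul_of_hasCompactSupport_left (cdxW e) (sdxW e) cη) (fun z _ => ddxW e z)
        (fun z _ => dη z)
    rw [s1, s2, neg_neg]
  have hl : ∫ z, W z * lap η z = ∫ z, lap W z * η z := by
    have i1 : ∀ i, Integrable (fun z => W z * dx (b i) (dx (b i) η) z) := fun i =>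
      integrable_mul_of_hasCompactSupport_left cW hWc (cddη _)
    have i2 : ∀ i, Integrable (fun z => dx (b i) (dx (b i) W) z * η z) := fun i =>
      integrable_mul_of_hasCompactSupport_left (cddW _) (sddW _) cη
    calc ∫ z, W z * lap η z = ∫ z, ∑ i, W z * dx (b i) (dx (b i) η) z := by
          refine integral_congr_ae (Eventually.of_forall fun z => ?_)
          show W z * lap η z = ∑ i, W z * dx (b i) (dx (b i) η) z
          rw [lap, Finset.mul_sum]
      _ = ∑ i, ∫ z, W z * dx (b i) (dx (b i) η) z := integral_finsetSum _ fun i _ => i1 i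
      _ = ∑ i, ∫ z, dx (b i) (dx (b i) W) z * η z := Finset.sum_congr rfl fun i _ => hx (b i)
      _ = ∫ z, ∑ i, dx (b i) (dx (b i) W) z * η z := (integral_finsetSum _ fun i _ => i2 i).symm
      _ = ∫ z, lap W z * η z := by
          refine integral_congr_ae (Eventually.of_forall fun z => ?_)
          show ∑ i, dx (b i) (dx (b i) W) z * η z = lap W z * η z
          rw [lap, Finset.sum_mul]
  -- assemble
  have j1 : Integrable fun z => W z * dt η z := integrable_mul_of_hasCompactSupport_left cW hWc cdtη
  have j2 : Integrable fun z => W z * lap η z :=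
    integrable_mul_of_hasCompactSupport_left cW hWc (continuous_lap_of_contDiff_two hη2)
  have j3 : Integrable fun z => dt W z * η z := integrable_mul_of_hasCompactSupport_left cdtW sdtW cη
  have j4 : Integrable fun z => lap W z * η z :=
    integrable_mul_of_hasCompactSupport_left (continuous_lap_of_contDiff_two hW)
      (hasCompactSupport_lap hWc) cη
  calc ∫ z, W z * g z.1 z.2 = ∫ z, (-(W z * dt η z) - W z * lap η z) := by
        refine integral_congr_ae (Eventually.of_forall fun z => ?_)
        show W z * g z.1 z.2 = -(W z * dt η z) - W z * lap η z
        rw [heq z]; ring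
    _ = -(∫ z, W z * dt η z) - ∫ z, W z * lap η z := by
        have j1' : Integrable fun z => -(W z * dt η z) := j1.neg
        rw [integral_sub j1' j2, integral_neg]
    _ = (∫ z, dt W z * η z) - ∫ z, lap W z * η z := by rw [ht, hl, neg_neg]
    _ = ∫ z, (dt W z - lap W z) * η z := by
        rw [← integral_sub j3 j4]
        refine integral_congr_ae (Eventually.of_forall fun z => ?_)
        show dt W z * η z - lap W z * η z = (dt W z - lap W z) * η z
        ring

end Duality

/-! ### The representation formulas for the heat operator `∂ₜ - Δ` -/

section Forward

variable {W : ℝ × E → ℝ}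

/-- Data of the source `F = ∂ₜW - ΔW` consumed by the potential machinery: integrable, bounded,
with bounded time support. [folklore] -/
theorem exists_source_data (hW : ContDiff ℝ 2 W) (hWc : HasCompactSupport W) :
    ∃ M a b : ℝ, 0 ≤ M ∧ Integrable (fun z => dt W z - lap W z) (volume : Measure (ℝ × E)) ∧
      (∀ᵐ z ∂(volume : Measure (ℝ × E)), |dt W z - lap W z| ≤ M) ∧
      (∀ᵐ z ∂(volume : Measure (ℝ × E)), dt W z - lap W z ≠ 0 → z.1 ∈ Icc a b) := by
  have hc := continuous_dt_sub_lap hW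
  have hs := hasCompactSupport_dt_sub_lap hWc
  obtain ⟨M, hM⟩ := hc.bounded_above_of_compact_support hs
  obtain ⟨r, hr⟩ := (hs.isCompact.image continuous_fst).isBounded.subset_closedBall 0
  refine ⟨M, -r, r, (norm_nonneg _).trans (hM 0), hc.integrable_of_hasCompactSupport hs,
    Eventually.of_forall fun z => (Real.norm_eq_abs _).symm.le.trans (hM z),
    Eventually.of_forall fun z hz => ?_⟩
  have h1 : z.1 ∈ Metric.closedBall (0 : ℝ) r :=
    hr (mem_image_of_mem _ (subset_tsupport _ (mem_support.2 hz)))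
  rw [Metric.mem_closedBall, dist_zero_right, Real.norm_eq_abs, abs_le] at h1
  exact h1

omit [FiniteDimensional ℝ E] [MeasurableSpace E] [BorelSpace E] in
/-- A smooth compactly supported function on `ℝ × E`, curried, is a space–time test function on
the whole space. [folklore] -/
theorem isSpaceTimeTestOn_top_curry {γ : ℝ × E → ℝ} (hγ : ContDiff ℝ ((⊤ : ℕ∞) : WithTop ℕ∞) γ)
    (hγc : HasCompactSupport γ) : IsSpaceTimeTestOn (⊤ : Opens (ℝ × E)) fun t x => γ (t, x) where
  contDiff := hγ
  hasCompactSupport := hγc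
  tsupport_subset := fun _ _ => trivial

/-- **Duhamel's formula (forward heat operator) for compactly supported `C²` functions**:
`W(t, x) = ∫ backKernel G (w - (t,x)) (∂ₜW - ΔₓW)(w) dw = ∫_{s<t} ∫ G_{t-s}(y - x) (∂ₜW - ΔₓW)(s,y) dy ds`
(Evans, *PDE*, §2.3.1 Thm. 2, read as a representation of `W`). [folklore] -/
theorem eq_integral_backKernel_mul_dt_sub_lap (hW : ContDiff ℝ 2 W) (hWc : HasCompactSupport W)
    (z : ℝ × E) :
    W z = ∫ w, backKernel (UnboundedOperators.heatKernel (E := E)) (w - z) * (dt W w - lap W w) := by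
  haveI : (volume : Measure (ℝ × E)).IsAddHaarMeasure := Measure.prod.instIsAddHaarMeasure _ _
  set K : ℝ × E → ℝ := backKernel (UnboundedOperators.heatKernel (E := E)) with hKdef
  set Fs : ℝ × E → ℝ := fun w => dt W w - lap W w with hFs
  obtain ⟨M, a, b, hM, hFi, hFM, hFsupp⟩ := exists_source_data hW hWc
  have hK := isSliceBoundKernel_backKernel_heatKernel (E := E)
  set P : ℝ × E → ℝ := (fun v => K (-v)) ⋆[lsmul ℝ ℝ, (volume : Measure (ℝ × E))] Fs with hP
  have hPc : Continuous P := hK.reflect.continuous_convolution hFi hM hFM hFsupp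
  have cW : Continuous W := hW.continuous
  -- testing against an arbitrary smooth compactly supported `γ`
  have key : ∀ γ : ℝ × E → ℝ, ContDiff ℝ ((⊤ : ℕ∞) : WithTop ℕ∞) γ → HasCompactSupport γ →
      ∫ w, γ w • W w = ∫ w, γ w • P w := by
    intro γ hγ hγc
    have hg := isSpaceTimeTestOn_top_curry hγ hγc
    have h1 := integral_mul_test_eq_integral_dt_sub_lap_mul_duhamel hW hWc hg
    have hX : ∀ w, Fs w ≠ 0 → (fun w : ℝ × E => heatDuhamelBack 1 (fun t x => γ (t, x)) w.1 w.2) w =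
        (K ⋆[lsmul ℝ ℝ, (volume : Measure (ℝ × E))] uncurry fun t x => γ (t, x)) w :=
      fun w _ => heatDuhamelBack_one_eq_convolution_heatKernel hg w.1 w.2
    have h2 := (duality_term_sliceBound hK hg hX hFi hM hFM hFsupp).1
    have e1 : ∫ w, γ w • W w = ∫ w, W w * γ (w.1, w.2) :=
      integral_congr_ae (Eventually.of_forall fun w => by
        show γ w * W w = W w * γ (w.1, w.2)
        rw [Prod.mk.eta, mul_comm])
    have e2 : ∫ w, γ w • P w = ∫ w, (uncurry fun t x => γ (t, x)) w * P w :=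
      integral_congr_ae (Eventually.of_forall fun w => rfl)
    rw [e1, h1, e2, ← h2]
  have hae : ∀ᵐ w ∂(volume : Measure (ℝ × E)), W w = P w :=
    ae_eq_of_integral_contDiff_smul_eq cW.locallyIntegrable hPc.locallyIntegrable key
  have hev : W = P := (Continuous.ae_eq_iff_eq volume cW hPc).1 hae
  rw [show W z = P z by rw [hev], hP, convolution_reflect_lsmul_real_prod_apply]

/-- **The gradient of Duhamel's formula**:
`∂ᵥW(t, x) = -∫ backKernel (∂ᵥG) (w - (t,x)) (∂ₜW - ΔₓW)(w) dw`, i.e.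
`∂ᵥW(t,x) = ∫_{s<t} ∫ (∂ᵥG_{t-s})(x - y) (∂ₜW - ΔₓW)(s,y) dy ds`. [folklore] -/
theorem dx_eq_neg_integral_backKernel_mul_dt_sub_lap (hW : ContDiff ℝ 2 W)
    (hWc : HasCompactSupport W) (v : E) (z : ℝ × E) :
    dx v W z = -∫ w, backKernel (heatKernelGrad v) (w - z) * (dt W w - lap W w) := by
  haveI : (volume : Measure (ℝ × E)).IsAddHaarMeasure := Measure.prod.instIsAddHaarMeasure _ _
  set K : ℝ × E → ℝ := backKernel (heatKernelGrad (E := E) v) with hKdef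
  set Fs : ℝ × E → ℝ := fun w => dt W w - lap W w with hFs
  obtain ⟨M, a, b, hM, hFi, hFM, hFsupp⟩ := exists_source_data hW hWc
  have hK := isSliceBoundKernel_backKernel_heatKernelGrad (E := E) v
  set P : ℝ × E → ℝ := (fun v => K (-v)) ⋆[lsmul ℝ ℝ, (volume : Measure (ℝ × E))] Fs with hP
  have hPc : Continuous P := hK.reflect.continuous_convolution hFi hM hFM hFsupp
  have cW : Continuous W := hW.continuous
  have cdW : Continuous (dx v W) := continuous_dx_of_contDiff_two hW v
  have dW : ∀ z, DifferentiableAt ℝ W z := fun z => hW.differentiable (by simp) z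
  have key : ∀ γ : ℝ × E → ℝ, ContDiff ℝ ((⊤ : ℕ∞) : WithTop ℕ∞) γ → HasCompactSupport γ →
      ∫ w, γ w • dx v W w = ∫ w, γ w • (-P w) := by
    intro γ hγ hγc
    have hg := isSpaceTimeTestOn_top_curry hγ hγc
    have hgv := hg.fderiv_apply_top v
    have dγ : ∀ z, DifferentiableAt ℝ γ z := fun z => hγ.differentiable (by simp) z
    have cγ : Continuous γ := hγ.continuous
    have cdγ : Continuous (dx v γ) :=
      continuous_dx_of_contDiff_two (contDiff_two_of_top hγ) v
    -- (a) move the derivative onto the test function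
    have ha : ∫ w, γ w * dx v W w = -∫ w, dx v γ w * W w := by
      simp only [dx_apply]
      exact integral_mul_fderiv_eq_neg_fderiv_mul_of_integrable
        (integrable_mul_of_hasCompactSupport_left cdγ (hasCompactSupport_dx hγc v) cW)
        (integrable_mul_of_hasCompactSupport_left cγ hγc cdW)
        (integrable_mul_of_hasCompactSupport_left cγ hγc cW) (fun z _ => dγ z) (fun z _ => dW z)
    -- (b) `∂ᵥγ̃` is the test function `∂ᵥg`
    have hb : ∀ w : ℝ × E, dx v γ w = fderiv ℝ (fun x => γ (w.1, x)) w.2 v := fun w => by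
      rw [dx_apply, show w = (w.1, w.2) from rfl]
      exact fderiv_apply_zero_eq_fderiv_slice (dγ _) v
    -- (c) duality for the test function `∂ᵥg`
    have h1 := integral_mul_test_eq_integral_dt_sub_lap_mul_duhamel hW hWc hgv
    have hX : ∀ w, Fs w ≠ 0 →
        (fun w : ℝ × E => heatDuhamelBack 1 (fun t x => fderiv ℝ (fun y => γ (t, y)) x v) w.1 w.2) w =
        (K ⋆[lsmul ℝ ℝ, (volume : Measure (ℝ × E))] uncurry fun t x => γ (t, x)) w := by
      intro w _
      show heatDuhamelBack 1 (fun t x => fderiv ℝ (fun y => γ (t, y)) x v) w.1 w.2 = _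
      rw [← hg.fderiv_heatDuhamelBack_apply one_pos w.1 w.2 v]
      exact fderiv_heatDuhamelBack_one_eq_convolution_heatKernelGrad hg w.1 w.2 v
    have h2 := (duality_term_sliceBound hK hg hX hFi hM hFM hFsupp).1
    have e1 : ∫ w, γ w • dx v W w = -∫ w, W w * fderiv ℝ (fun y => γ (w.1, y)) w.2 v := by
      have : ∫ w, γ w • dx v W w = ∫ w, γ w * dx v W w :=
        integral_congr_ae (Eventually.of_forall fun w => by simp)
      rw [this, ha]
      congr 1
      exact integral_congr_ae (Eventually.of_forall fun w => by
        show dx v γ w * W w = W w * fderiv ℝ (fun y => γ (w.1, y)) w.2 v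
        rw [hb w, mul_comm])
    have e2 : ∫ w, γ w • (-P w) = -∫ w, (uncurry fun t x => γ (t, x)) w * P w := by
      rw [← integral_neg]
      exact integral_congr_ae (Eventually.of_forall fun w => by
        show γ w * -P w = -(γ (w.1, w.2) * P w)
        ring)
    rw [e1, h1, e2, ← h2]
  have hae : ∀ᵐ w ∂(volume : Measure (ℝ × E)), dx v W w = -P w :=
    ae_eq_of_integral_contDiff_smul_eq cdW.locallyIntegrable hPc.neg.locallyIntegrable key
  have hev : dx v W = fun w => -P w := (Continuous.ae_eq_iff_eq volume cdW hPc.neg).1 hae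
  rw [show dx v W z = -P z by rw [hev], hP, convolution_reflect_lsmul_real_prod_apply]

end Forward

/-! ### Time reflection and the representation formulas for the backward operator `∂ₜ + Δ` -/

section Backward

variable {F : Type*} [NormedAddCommGroup F] [NormedSpace ℝ F] {W : ℝ × E → F}

omit [MeasurableSpace E] [BorelSpace E] [FiniteDimensional ℝ E] in
/-- The time reflection `(t, x) ↦ (-t, x)` as a continuous linear map of `ℝ × E`. [folklore] -/
theorem timeReflectCLM_apply (z : ℝ × E) :
    ((-ContinuousLinearMap.fst ℝ ℝ E).prod (ContinuousLinearMap.snd ℝ ℝ E)) z = (-z.1, z.2) := rfl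

omit [MeasurableSpace E] [BorelSpace E] [FiniteDimensional ℝ E] in
/-- A time-reflected `Cⁿ` function is `Cⁿ`. [folklore] -/
theorem contDiff_comp_timeReflect {n : WithTop ℕ∞} (hW : ContDiff ℝ n W) :
    ContDiff ℝ n fun z : ℝ × E => W (-z.1, z.2) :=
  hW.comp ((-ContinuousLinearMap.fst ℝ ℝ E).prod (ContinuousLinearMap.snd ℝ ℝ E)).contDiff

omit [MeasurableSpace E] [BorelSpace E] [FiniteDimensional ℝ E] [InnerProductSpace ℝ E]
  [NormedSpace ℝ F] in
/-- A time-reflected compactly supported function is compactly supported. [folklore] -/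
theorem hasCompactSupport_comp_timeReflect [NormedSpace ℝ E] (hWc : HasCompactSupport W) :
    HasCompactSupport fun z : ℝ × E => W (-z.1, z.2) :=
  hWc.comp_homeomorph ((Homeomorph.neg ℝ).prodCongr (Homeomorph.refl E))

omit [MeasurableSpace E] [BorelSpace E] [FiniteDimensional ℝ E] in
/-- Chain rule for the time reflection: `D(W ∘ R)(z) v = DW(Rz)(Rv)`, `R(t, x) = (-t, x)`.
[folklore] -/
theorem fderiv_comp_timeReflect_apply {z : ℝ × E} (hW : DifferentiableAt ℝ W (-z.1, z.2))
    (v : ℝ × E) :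
    fderiv ℝ (fun w : ℝ × E => W (-w.1, w.2)) z v = fderiv ℝ W (-z.1, z.2) (-v.1, v.2) := by
  set R : ℝ × E →L[ℝ] ℝ × E := (-ContinuousLinearMap.fst ℝ ℝ E).prod (ContinuousLinearMap.snd ℝ ℝ E)
  have hR : ∀ w : ℝ × E, R w = (-w.1, w.2) := fun w => rfl
  have hcomp : (fun w : ℝ × E => W (-w.1, w.2)) = W ∘ R := by funext w; simp [hR]
  have hW' : DifferentiableAt ℝ W (R z) := by rwa [hR]
  rw [hcomp, fderiv_comp z hW' R.differentiableAt, R.fderiv, ContinuousLinearMap.comp_apply, hR, hR]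

omit [MeasurableSpace E] [BorelSpace E] [FiniteDimensional ℝ E] in
/-- `∂ₜ(W ∘ R)(z) = -∂ₜW(Rz)` for the time reflection `R`. [folklore] -/
theorem dt_comp_timeReflect {z : ℝ × E} (hW : DifferentiableAt ℝ W (-z.1, z.2)) :
    dt (fun w : ℝ × E => W (-w.1, w.2)) z = -dt W (-z.1, z.2) := by
  rw [dt_apply, dt_apply, fderiv_comp_timeReflect_apply hW, ← map_neg]
  congr 1
  simp

omit [MeasurableSpace E] [BorelSpace E] [FiniteDimensional ℝ E] in
/-- `∂ₑ(W ∘ R)(z) = ∂ₑW(Rz)` for the time reflection `R`. [folklore] -/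
theorem dx_comp_timeReflect {z : ℝ × E} (hW : DifferentiableAt ℝ W (-z.1, z.2)) (e : E) :
    dx e (fun w : ℝ × E => W (-w.1, w.2)) z = dx e W (-z.1, z.2) := by
  rw [dx_apply, dx_apply, fderiv_comp_timeReflect_apply hW]
  simp

omit [MeasurableSpace E] [BorelSpace E] [FiniteDimensional ℝ E] in
/-- `∂ₑ(W ∘ R) = (∂ₑW) ∘ R` for an everywhere differentiable `W`. [folklore] -/
theorem dx_comp_timeReflect_eq (hW : Differentiable ℝ W) (e : E) :
    dx e (fun w : ℝ × E => W (-w.1, w.2)) = fun z => dx e W (-z.1, z.2) :=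
  funext fun _ => dx_comp_timeReflect (hW _) e

omit [MeasurableSpace E] [BorelSpace E] in
/-- `Δₓ(W ∘ R)(z) = ΔₓW(Rz)` for the time reflection `R` and `W ∈ C²`. [folklore] -/
theorem lap_comp_timeReflect (hW : ContDiff ℝ 2 W) (z : ℝ × E) :
    lap (fun w : ℝ × E => W (-w.1, w.2)) z = lap W (-z.1, z.2) := by
  have hd : Differentiable ℝ W := hW.differentiable (by simp)
  have hd1 : ∀ e, Differentiable ℝ (dx e W) := fun e =>
    (contDiff_one_dx_of_contDiff_two hW e).differentiable one_ne_zero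
  simp only [lap]
  refine Finset.sum_congr rfl fun i _ => ?_
  rw [dx_comp_timeReflect_eq hd, dx_comp_timeReflect ((hd1 _) _)]

/-- The time reflection `(t, x) ↦ (-t, x)` (the measurable equivalence
`(MeasurableEquiv.neg ℝ).prodCongr (MeasurableEquiv.refl E)`) preserves Lebesgue measure on
`ℝ × E`. [folklore] -/
theorem measurePreserving_timeReflect :
    MeasurePreserving ((MeasurableEquiv.neg ℝ).prodCongr (MeasurableEquiv.refl E))
      (volume : Measure (ℝ × E)) volume :=
  (Measure.measurePreserving_neg (volume : Measure ℝ)).prod (MeasurePreserving.id (volume : Measure E))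

/-- Substitution `w ↦ (-s, y)` in a space–time integral. [folklore] -/
theorem integral_comp_timeReflect {G : Type*} [NormedAddCommGroup G] [NormedSpace ℝ G]
    (f : ℝ × E → G) : ∫ w : ℝ × E, f (-w.1, w.2) = ∫ w, f w :=
  (measurePreserving_timeReflect (E := E)).integral_comp' f

end Backward

section BackwardRep

variable {W : ℝ × E → ℝ}

/-- **Duhamel's formula for the backward heat operator** `∂ₜ + Δ` and compactly supported `C²`
functions: `W(t, x) = -∫ backKernel G (t - s, y - x) (∂ₜW + ΔₓW)(s, y) d(s, y)`
`= -∫_{s > t} ∫ G_{s-t}(y - x) (∂ₜW + ΔₓW)(s, y) dy ds` — the value at time `t` is determined by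
the source in the future (time reflection of `eq_integral_backKernel_mul_dt_sub_lap`).
[folklore] -/
theorem eq_neg_integral_backKernel_mul_dt_add_lap (hW : ContDiff ℝ 2 W) (hWc : HasCompactSupport W)
    (z : ℝ × E) :
    W z = -∫ w : ℝ × E, backKernel (UnboundedOperators.heatKernel (E := E)) (z.1 - w.1, w.2 - z.2) *
      (dt W w + lap W w) := by
  have hWr := contDiff_comp_timeReflect hW
  have hWrc := hasCompactSupport_comp_timeReflect (E := E) hWc
  have hd : Differentiable ℝ W := hW.differentiable (by simp)
  have h := eq_integral_backKernel_mul_dt_sub_lap hWr hWrc (-z.1, z.2)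
  simp only [neg_neg, Prod.mk.eta] at h
  rw [h, ← integral_comp_timeReflect, ← integral_neg]
  refine integral_congr_ae (Eventually.of_forall fun w => ?_)
  show backKernel UnboundedOperators.heatKernel ((-w.1, w.2) - (-z.1, z.2)) *
      (dt (fun w : ℝ × E => W (-w.1, w.2)) (-w.1, w.2) - lap (fun w : ℝ × E => W (-w.1, w.2)) (-w.1, w.2)) =
    -(backKernel UnboundedOperators.heatKernel (z.1 - w.1, w.2 - z.2) * (dt W w + lap W w))
  rw [dt_comp_timeReflect (hd _), lap_comp_timeReflect hW]
  simp only [neg_neg, Prod.mk.eta, Prod.mk_sub_mk]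
  rw [show -w.1 - -z.1 = z.1 - w.1 by ring]
  ring

/-- **The gradient of the backward Duhamel formula**:
`∂ᵥW(t, x) = ∫ backKernel (∂ᵥG) (t - s, y - x) (∂ₜW + ΔₓW)(s, y) d(s, y)`
`= ∫_{s > t} ∫ (∂ᵥG_{s-t})(y - x) (∂ₜW + ΔₓW)(s, y) dy ds`. [folklore] -/
theorem dx_eq_integral_backKernel_mul_dt_add_lap (hW : ContDiff ℝ 2 W) (hWc : HasCompactSupport W)
    (v : E) (z : ℝ × E) :
    dx v W z = ∫ w : ℝ × E, backKernel (heatKernelGrad v) (z.1 - w.1, w.2 - z.2) *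
      (dt W w + lap W w) := by
  have hWr := contDiff_comp_timeReflect hW
  have hWrc := hasCompactSupport_comp_timeReflect (E := E) hWc
  have hd : Differentiable ℝ W := hW.differentiable (by simp)
  have h := dx_eq_neg_integral_backKernel_mul_dt_sub_lap hWr hWrc v (-z.1, z.2)
  rw [dx_comp_timeReflect (hd _)] at h
  simp only [neg_neg, Prod.mk.eta] at h
  rw [h, ← integral_comp_timeReflect, ← integral_neg]
  refine integral_congr_ae (Eventually.of_forall fun w => ?_)
  show -(backKernel (heatKernelGrad v) ((-w.1, w.2) - (-z.1, z.2)) *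
      (dt (fun w : ℝ × E => W (-w.1, w.2)) (-w.1, w.2) - lap (fun w : ℝ × E => W (-w.1, w.2)) (-w.1, w.2))) =
    backKernel (heatKernelGrad v) (z.1 - w.1, w.2 - z.2) * (dt W w + lap W w)
  rw [dt_comp_timeReflect (hd _), lap_comp_timeReflect hW]
  simp only [neg_neg, Prod.mk.eta, Prod.mk_sub_mk]
  rw [show -w.1 - -z.1 = z.1 - w.1 by ring]
  ring

end BackwardRep

end Carleman

end Literature.Analysis.FluidPDE
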